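import Summits.CriticalPhenomena.PercolationContinuityZ3.Theorems.PercNearOneGluingNoHeavyLowerTailStarSetHairAMGM
import HarnessLib

/-!
# `NoHeavyLowerTail` (stmt-CriticalPhenomena-4575) — glue inequalities for the U0' assembly (MWF-CERT §7.6 (c))

Support file (prover `prim-gen-swap` gen 9; `--supports stmt-CriticalPhenomena-4575`).  No definitions, no named facts, no sorries.

* `StarSet.one_sub_prod_le_sum` — `1 − Π_{i∈s}(1−θ_i) ≤ Σ_{i∈s} θ_i` for `θ ∈ [0,1]` (class weight ≤ sum of star weights);
* `StarSet.le_classWeight_of_mem` — `θ_i ≤ 1 − Π_{k∈s}(1−θ_k)` for `i ∈ s`;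
* `StarSet.sqrt_le_sum_sqrt_of_dominated` — if the class `N` dominates the class `K ∋ i` (`Π_N(1−θ) ≤ Π_K(1−θ)`), then
  `√θ_i ≤ Σ_{n∈N} √θ_n` — the hypothesis `hS` of `StarSet.two_word_supply` / `StarSet.pair_charge_le`.
-/

namespace Summit.CriticalPhenomena.PercolationContinuityZ3.Theorems

open Finset
open scoped BigOperators

namespace StarSet

variable {ι : Type*}

/-- `1 − Π(1−θ) ≤ Σ θ` on `[0,1]` (union bound). [folklore] -/
theorem one_sub_prod_le_sum [DecidableEq ι] (s : Finset ι) (θ : ι → ℝ) (hθ0 : ∀ i, 0 ≤ θ i) (hθ1 : ∀ i, θ i ≤ 1) :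
    1 - ∏ i ∈ s, (1 - θ i) ≤ ∑ i ∈ s, θ i := by
  induction s using Finset.induction_on with
  | empty => simp
  | @insert a s ha ih =>
    rw [prod_insert ha, sum_insert ha]
    have hP0 : 0 ≤ ∏ i ∈ s, (1 - θ i) := prod_nonneg fun i _ => sub_nonneg.2 (hθ1 i)
    have hP1 : ∏ i ∈ s, (1 - θ i) ≤ 1 := prod_le_one (fun i _ => sub_nonneg.2 (hθ1 i)) fun i _ => sub_le_self _ (hθ0 i)
    nlinarith [hθ0 a, hθ1 a]

/-- A member's weight is at most the class weight. [folklore] -/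
theorem le_classWeight_of_mem [DecidableEq ι] (s : Finset ι) (θ : ι → ℝ) (hθ0 : ∀ i, 0 ≤ θ i) (hθ1 : ∀ i, θ i ≤ 1)
    {i : ι} (hi : i ∈ s) : θ i ≤ 1 - ∏ k ∈ s, (1 - θ k) := by
  rw [← mul_prod_erase s (fun k => 1 - θ k) hi]
  have hP0 : 0 ≤ ∏ k ∈ s.erase i, (1 - θ k) := prod_nonneg fun k _ => sub_nonneg.2 (hθ1 k)
  have hP1 : ∏ k ∈ s.erase i, (1 - θ k) ≤ 1 := prod_le_one (fun k _ => sub_nonneg.2 (hθ1 k)) fun k _ => sub_le_self _ (hθ0 k)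
  nlinarith [hθ0 i, hθ1 i]

/-- **The third class supplies `√θ_i`.**  See the file header. [MWF-CERT.md §5 Step 2] -/
theorem sqrt_le_sum_sqrt_of_dominated [DecidableEq ι] (K N : Finset ι) (θ : ι → ℝ) (hθ0 : ∀ i, 0 ≤ θ i) (hθ1 : ∀ i, θ i ≤ 1)
    {i : ι} (hi : i ∈ K) (hdom : ∏ n ∈ N, (1 - θ n) ≤ ∏ k ∈ K, (1 - θ k)) :
    Real.sqrt (θ i) ≤ ∑ n ∈ N, Real.sqrt (θ n) := by
  have h1 : θ i ≤ 1 - ∏ k ∈ K, (1 - θ k) := le_classWeight_of_mem K θ hθ0 hθ1 hi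
  have h2 : 1 - ∏ k ∈ K, (1 - θ k) ≤ 1 - ∏ n ∈ N, (1 - θ n) := by linarith
  calc Real.sqrt (θ i) ≤ Real.sqrt (1 - ∏ n ∈ N, (1 - θ n)) := Real.sqrt_le_sqrt (h1.trans h2)
    _ ≤ ∑ n ∈ N, Real.sqrt (θ n) := sqrt_classWeight_le_sum_sqrt N θ hθ0 hθ1

end StarSet

end Summit.CriticalPhenomena.PercolationContinuityZ3.Theorems
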